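import Summits.QuantumFields.BalabanUV.T4Continuum.Support.ShellMeasureLandauHolonomyChart

/-!
# `T4Continuum.ShellMeasureLandauHolonomyReal` — THE CANONICAL LANDAU EXPONENT IS REAL AT REAL DATA:
# the canonical solution `solAt` of B11 Prop. 6's scheme and the canonical Landau correction `corrAt` of (50) lie in
# every closed set containing `0` that the respective contraction preserves; hence, for closed «real» subgroups
# preserved by the scheme maps, the exponent field of file 7″ §3 is real at every real chart point
(cell `pub-balaban`, sub-cell `t4`, spine estimate NE7c (node U5b); NE7c formalisation swarm, crew seat
`b2b-balaban-t4-ne7c-formalise-leaf-02` gen 4 — file (A) of the OFFER «S22 ROAD, THE WEIGHT SIDE»; imports this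
lineage's `ShellMeasureLandauHolonomyChart` (file 7″, p212418; hence 7′ `ShellMeasureLandauHolonomy` p212141) ONLY; 0 `def`,
0 `def … : Prop`, 0 sorry)

HONEST FRAMING.  Finite four-torus programme, rung (B)+1 only — NOT infinite volume, NOT a mass gap, NOT the Clay
problem, NOT summit progress; (B), `BetaPertHyp`, (B^μ) not consumed.  NE7c (`T4IndicatorShell.ShellWeightBound`) is
NOT PRINTED and NOT PROVED; «NE7c ⇐ the named binders».  Nothing printed in [Balaban1985Variational] is asserted: (P2),
(P4), (118)/(121), (44)+[4] Prop. 7, (46), (54), (75)/(103) stay TYPED HYPOTHESES of the imported files, by name; the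
REAL STRUCTURE below (closed additive subgroups preserved by the scheme maps) is a further DISPLAYED-TYPE binder —
print's «configurations with values in the (complexified) Lie algebra» ((115), (176), p. 296 l. 1) — asserted by
nobody, instantiated by nobody here.

WHY (the weight side of the S22 END).  END-II / E2′ (`ShellMeasureRootCompositionLevelZero.slotAC_realized_su2_of_
levelData_cube`) asks TWO plaquette-functional binders along the contraction rays of the chart: SM-L1 `hAN` for the
CLASSIFIER holonomies `hol p` and SM-L3 `hGW` for the WEIGHT words `G p`.  Files 7′/7″ made `hol` a DEFINITION (the word
of exponentials of the read-outs of the canonical Landau exponent field `Z`) and met `hAN` in its own shape; the S22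
END of `ShellMeasureLandauHolonomyEnd` (leaf-05-g4) accordingly carries `hol` defined and `G`/`hGW` FREE.  The
weight-side letters must be ADMISSIBLE (`ShellMeasureWilsonMoving.MLetter.Good`): on the REAL segment `c ∈ [0,1]` the
bond read-out is `τ`-free with a contracting exponential — the (sk) TYPE that `ShellMeasureBlockWiring.hGW_of_
blockBondData` asks per bond.  For a DEFINED exponent field this is a statement of REALITY: at real chart points the
canonical objects take values in the real (Lie-algebra-valued) configurations.  This file proves exactly that, from
uniqueness/invariance, with the real structure displayed as data:
* §1 `solAt_mem_of_invariant` — under the scheme's hypotheses ((P2), (P4), (118)/(121)) THE solution lies in every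
  closed `S ∋ 0` that (116) maps into itself on the `ε₄`-ball (`B11Prop6Scheme.solution_mem_of_invariant` BY NAME —
  its docstring names this use: «for reality of the solution»); `solAt_mem_addSubgroup` — the packaged form for a
  closed additive subgroup `𝓡𝒴` with `𝒢 (𝓡𝒵) ⊆ 𝓡𝒴`, `Λ (𝓡𝒴) ⊆ 𝓡𝒴`, `W (𝓡𝒴) ⊆ 𝓡𝒵` and real data `J`, `𝔄`.
* §2 `corrAt_mem_of_invariant` — under Sect. C's hypotheses ((44) `hCq`/`hCd`, scaling `hι`, (46) `hH`, (54)-smallness)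
  THE Landau correction at `‖Y‖ < ε` lies in every closed `S ∋ 0` that `X′ ↦ C(ιY − ιHX′)` maps into itself on the
  closed ball `4C₂ε²` (`B13Contraction113.mapsTo_T`/`lipschitz_T` + `B8SectDSource.fixedPoint_mem_of_invariant` BY
  NAME); `corrAt_mem_addSubgroup`, `landauExp_mem_addSubgroup` — packaged forms.
* §3 `landauField_mem_real` — THE CHART INSTANCE of file 7″ §3: with closed real subgroups of `𝒴`, `𝒳` and real
  subgroups of `𝒵`, `𝒴′`, `ℬ` preserved by `𝒢`, `W𝒱`, `C`, `ι`, `H`, `H₁`, and a coarse-field map with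
  `Φ (cplx y) ∈ 𝓡ℬ` at real chart points `‖y‖ ≤ S` (`S < r_Φ`), the exponent field
  `Z y = landauExp C ι H (4C₂(ε₄+B₀b)²) (solAt 𝒢 0 W𝒱 ε₄ 0 (H₁ (Φ (cplx y))) + H₁ (Φ (cplx y)))` lies in `𝓡𝒴`.
File (B) `ShellMeasureLandauHolonomyWeight` turns this into END-II's `hGW` for the DEFINED weight words.  NOT an
instance of Bałaban's minimiser; NE7c NOT PROVED; spine PROVED 0/9.  HONEST DEPENDENCY (cell): continuum YM on T⁴ ⇐
BetaPertH ∧ nine spine estimates (0/9 proved); BetaPertH ⇐ (D1) ∧ (D4) ∧ CAP+tail; G-an2-4 gates asym, D1 and NE2/3/4.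
-/

noncomputable section

open Set Metric NormedSpace

namespace Summit.QuantumFields.BalabanUV.T4Continuum.ShellMeasureLandauHolonomyReal

open Literature.MathematicalPhysics.QuantumFieldTheory.Balaban1983to89
open B11Prop6Scheme (mapT Prop4Hyp norm_arg_lt existsUnique_solution solution_mem_of_invariant)
open B13Contraction113 (mapsTo_T lipschitz_T exists_unique_fixedPoint)
open B8SectDSource (fixedPoint_mem_of_invariant)
open ShellMeasureLandauFixedPoint (quadAnalytic_of_frechet)
open ShellMeasureLandauHolonomy (solAt corrAt landauExp solAt_spec corrAt_spec landauExp_apply)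
open ShellMeasureLandauHolonomyChart (cplx norm_cplx_le)

variable {𝒴 𝒴' 𝒳 𝒵 : Type*} [NormedAddCommGroup 𝒴] [NormedSpace ℂ 𝒴] [NormedAddCommGroup 𝒴'] [NormedSpace ℂ 𝒴']
  [NormedAddCommGroup 𝒳] [NormedSpace ℂ 𝒳] [NormedAddCommGroup 𝒵] [NormedSpace ℂ 𝒵]

/-! ## §1 The canonical solution of the scheme lies in every closed invariant set -/

section Sol

variable [CompleteSpace 𝒴] {𝒢 : 𝒵 →L[ℂ] 𝒴} {Λ : 𝒴 →L[ℂ] 𝒴} {W : 𝒴 → 𝒵} {B₀ θ C₄ a₃ : ℝ}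

/-- **THE CANONICAL SOLUTION LIES IN EVERY CLOSED INVARIANT SET.**  Under the scheme's hypotheses ((P2) `h𝒢`/`hΛ`;
(P4) `hW`; data `‖J‖ ≤ j`, `‖𝔄‖ < a`; the numbers (118)/(121) `hdom`/`hself`/`hcontr`): for every CLOSED `S ⊆ 𝒴`
with `0 ∈ S` that the transformation (116) `mapT 𝒢 Λ W J 𝔄` maps into itself on the ball `‖X‖ ≤ ε₄`, THE solution
`solAt 𝒢 Λ W ε₄ J 𝔄` lies in `S` (`B11Prop6Scheme.solution_mem_of_invariant` on the canonical choice). [folklore] -/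
theorem solAt_mem_of_invariant (h𝒢 : ∀ f, ‖𝒢 f‖ ≤ B₀ * ‖f‖) (hΛ : ∀ Y, ‖Λ Y‖ ≤ θ * ‖Y‖)
    (hW : Prop4Hyp W C₄ a₃) (hB₀ : 0 ≤ B₀) (hC₄ : 0 ≤ C₄) (hθ : 0 ≤ θ) {J : 𝒵} {j : ℝ} (hJ : ‖J‖ ≤ j)
    {𝔄 : 𝒴} {a ε₄ : ℝ} (h𝔄 : ‖𝔄‖ < a) (hε₄ : 0 ≤ ε₄) (hdom : 2 * (ε₄ + a) ≤ a₃)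
    (hself : B₀ * j + θ * (ε₄ + a) + B₀ * C₄ * (ε₄ + a) ^ 2 ≤ ε₄)
    (hcontr : θ + 4 * B₀ * C₄ * (ε₄ + a) < 1) (S : Set 𝒴) (hS : IsClosed S) (h0 : (0 : 𝒴) ∈ S)
    (hinv : ∀ X ∈ S, ‖X‖ ≤ ε₄ → mapT 𝒢 Λ W J 𝔄 X ∈ S) :
    solAt 𝒢 Λ W ε₄ J 𝔄 ∈ S := by
  obtain ⟨X, ⟨hX, hfix⟩, -⟩ :=
    existsUnique_solution h𝒢 hΛ hW.quadAnalytic hB₀ hC₄ hθ hJ h𝔄 hε₄ hdom hself hcontr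
  have h := solAt_spec (𝒢 := 𝒢) (Λ := Λ) (W := W) ⟨X, hX, hfix⟩
  exact solution_mem_of_invariant h𝒢 hΛ hW.quadAnalytic hB₀ hC₄ hθ hJ h𝔄 hε₄ hdom hself hcontr S hS h0 hinv
    h.1 h.2

/-- under the scheme's hypotheses THE solution lies in the ball `‖·‖ ≤ ε₄` and solves (116) (existence by
`B11Prop6Scheme.existsUnique_solution`, then `solAt_spec`). [folklore] -/
theorem solAt_spec_of_scheme (h𝒢 : ∀ f, ‖𝒢 f‖ ≤ B₀ * ‖f‖) (hΛ : ∀ Y, ‖Λ Y‖ ≤ θ * ‖Y‖)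
    (hW : Prop4Hyp W C₄ a₃) (hB₀ : 0 ≤ B₀) (hC₄ : 0 ≤ C₄) (hθ : 0 ≤ θ) {J : 𝒵} {j : ℝ} (hJ : ‖J‖ ≤ j)
    {𝔄 : 𝒴} {a ε₄ : ℝ} (h𝔄 : ‖𝔄‖ < a) (hε₄ : 0 ≤ ε₄) (hdom : 2 * (ε₄ + a) ≤ a₃)
    (hself : B₀ * j + θ * (ε₄ + a) + B₀ * C₄ * (ε₄ + a) ^ 2 ≤ ε₄)
    (hcontr : θ + 4 * B₀ * C₄ * (ε₄ + a) < 1) :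
    ‖solAt 𝒢 Λ W ε₄ J 𝔄‖ ≤ ε₄ ∧ mapT 𝒢 Λ W J 𝔄 (solAt 𝒢 Λ W ε₄ J 𝔄) = solAt 𝒢 Λ W ε₄ J 𝔄 := by
  obtain ⟨X, ⟨hX, hfix⟩, -⟩ :=
    existsUnique_solution h𝒢 hΛ hW.quadAnalytic hB₀ hC₄ hθ hJ h𝔄 hε₄ hdom hself hcontr
  exact solAt_spec (𝒢 := 𝒢) (Λ := Λ) (W := W) ⟨X, hX, hfix⟩

/-- **REALITY OF THE CANONICAL SOLUTION.**  A closed additive subgroup `𝓡𝒴 ≤ 𝒴` and an additive subgroup `𝓡𝒵 ≤ 𝒵`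
(«the real, Lie-algebra-valued configurations inside the complexified ones» — (115)/(176) TYPE) with
`𝒢 (𝓡𝒵) ⊆ 𝓡𝒴`, `Λ (𝓡𝒴) ⊆ 𝓡𝒴`, `W (𝓡𝒴) ⊆ 𝓡𝒵` («the operators are real»), and real data `J ∈ 𝓡𝒵`, `𝔄 ∈ 𝓡𝒴`:
THE solution is real, `solAt 𝒢 Λ W ε₄ J 𝔄 ∈ 𝓡𝒴`. [folklore] -/
theorem solAt_mem_addSubgroup (h𝒢 : ∀ f, ‖𝒢 f‖ ≤ B₀ * ‖f‖) (hΛ : ∀ Y, ‖Λ Y‖ ≤ θ * ‖Y‖)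
    (hW : Prop4Hyp W C₄ a₃) (hB₀ : 0 ≤ B₀) (hC₄ : 0 ≤ C₄) (hθ : 0 ≤ θ) {J : 𝒵} {j : ℝ} (hJ : ‖J‖ ≤ j)
    {𝔄 : 𝒴} {a ε₄ : ℝ} (h𝔄 : ‖𝔄‖ < a) (hε₄ : 0 ≤ ε₄) (hdom : 2 * (ε₄ + a) ≤ a₃)
    (hself : B₀ * j + θ * (ε₄ + a) + B₀ * C₄ * (ε₄ + a) ^ 2 ≤ ε₄)
    (hcontr : θ + 4 * B₀ * C₄ * (ε₄ + a) < 1)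
    (𝓡𝒴 : AddSubgroup 𝒴) (h𝓡𝒴 : IsClosed (𝓡𝒴 : Set 𝒴)) (𝓡𝒵 : AddSubgroup 𝒵)
    (h𝒢r : ∀ f ∈ 𝓡𝒵, 𝒢 f ∈ 𝓡𝒴) (hΛr : ∀ Y ∈ 𝓡𝒴, Λ Y ∈ 𝓡𝒴) (hWr : ∀ Y ∈ 𝓡𝒴, W Y ∈ 𝓡𝒵)
    (hJr : J ∈ 𝓡𝒵) (h𝔄r : 𝔄 ∈ 𝓡𝒴) :
    solAt 𝒢 Λ W ε₄ J 𝔄 ∈ (𝓡𝒴 : Set 𝒴) := by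
  refine solAt_mem_of_invariant h𝒢 hΛ hW hB₀ hC₄ hθ hJ h𝔄 hε₄ hdom hself hcontr (𝓡𝒴 : Set 𝒴) h𝓡𝒴
    𝓡𝒴.zero_mem fun X hX _ => ?_
  show -𝒢 J + Λ (X + 𝔄) - 𝒢 (W (X + 𝔄)) ∈ 𝓡𝒴
  have hX𝔄 : X + 𝔄 ∈ 𝓡𝒴 := 𝓡𝒴.add_mem hX h𝔄r
  exact 𝓡𝒴.sub_mem (𝓡𝒴.add_mem (𝓡𝒴.neg_mem (h𝒢r J hJr)) (hΛr _ hX𝔄)) (h𝒢r _ (hWr _ hX𝔄))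

end Sol

/-! ## §2 The canonical Landau correction lies in every closed invariant set; the Landau exponent is real -/

section Corr

variable [CompleteSpace 𝒳] {C : 𝒴' → 𝒳} {C₂ R : ℝ} {ι : 𝒴 →L[ℂ] 𝒴'} {H : 𝒳 →L[ℂ] 𝒴} {B₀ ε : ℝ}

/-- **THE CANONICAL LANDAU CORRECTION LIES IN EVERY CLOSED INVARIANT SET.**  Under Sect. C's hypotheses ((44)+[4] Prop. 7
`hCq`/`hCd` on `ball 0 R`; the scaling `hι`; (46) `hH`; the (54)-smallness `9C₂B₀ε < 1`, `3ε ≤ R`) at an exponent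
`‖Y‖ < ε`: for every CLOSED `S ⊆ 𝒳` with `0 ∈ S` that `X′ ↦ C(ι Y − ι(H X′))` maps into itself on the closed ball
`‖X′‖ ≤ 4C₂ε²`, THE correction `corrAt C ι H (4C₂ε²) Y` lies in `S` (`B13Contraction113.mapsTo_T`/`lipschitz_T` feed
`B8SectDSource.fixedPoint_mem_of_invariant`; uniqueness identifies the canonical choice). [folklore] -/
theorem corrAt_mem_of_invariant (hC₂ : 0 ≤ C₂) (hCq : ∀ Z : 𝒴', ‖Z‖ < R → ‖C Z‖ ≤ C₂ * ‖Z‖ ^ 2)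
    (hCd : DifferentiableOn ℂ C (ball 0 R)) (hι : ∀ Y, ‖ι Y‖ ≤ ‖Y‖) (hB₀ : 0 ≤ B₀)
    (hH : ∀ X, ‖H X‖ ≤ B₀ * ‖X‖) (hq : 9 * C₂ * B₀ * ε < 1) (hRC : 3 * ε ≤ R) {Y : 𝒴} (hY : ‖Y‖ < ε)
    (S : Set 𝒳) (hS : IsClosed S) (h0 : (0 : 𝒳) ∈ S)
    (hinv : ∀ X' ∈ S, ‖X'‖ ≤ 4 * C₂ * ε ^ 2 → C (ι Y - ι (H X')) ∈ S) :
    corrAt C ι H (4 * C₂ * ε ^ 2) Y ∈ S := by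
  have hC := quadAnalytic_of_frechet hCq hCd
  have hHop : ∀ X : 𝒳, ‖((ι.comp H : 𝒳 →L[ℂ] 𝒴') : 𝒳 →ₗ[ℂ] 𝒴') X‖ ≤ B₀ * ‖X‖ := fun X => (hι _).trans (hH X)
  have hA : ‖ι Y‖ < ε := (hι _).trans_lt hY
  have hε : 0 < ε := (norm_nonneg _).trans_lt hY
  have hR2 : 4 * C₂ * B₀ * ε ≤ 1 := by nlinarith
  have hRC2 : 2 * ε ≤ R := by linarith
  have hρ : 0 ≤ 4 * C₂ * ε ^ 2 := by positivity
  -- existence in the ball, hence the canonical choice is a fixed point there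
  obtain ⟨X₀, hX₀, hfix₀, -⟩ := exists_unique_fixedPoint hC hC₂ hB₀ hHop hA hq hRC
  have hspec := corrAt_spec (C := C) (ι := ι) (H := H) (r := 4 * C₂ * ε ^ 2) (Y := Y) ⟨X₀, hX₀, hfix₀⟩
  -- Banach's theorem on the closed ball, restricted to the closed invariant set
  refine fixedPoint_mem_of_invariant (fun X' => C (ι Y - ι (H X'))) hρ (by positivity) hq
    (fun X' hX' => mem_closedBall_zero_iff.1
      (mapsTo_T hC hC₂ hB₀ hHop hA hR2 hRC2 (mem_closedBall_zero_iff.2 hX')))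
    (fun X₁ X₂ h₁ h₂ => lipschitz_T hC hC₂ hB₀ hHop hA hR2 hRC (mem_closedBall_zero_iff.2 h₁)
      (mem_closedBall_zero_iff.2 h₂))
    S hS h0 hinv (mem_closedBall_zero_iff.1 hspec.1) hspec.2

/-- **REALITY OF THE CANONICAL LANDAU CORRECTION.**  Additive subgroups `𝓡𝒴 ≤ 𝒴`, `𝓡𝒴′ ≤ 𝒴′`, a CLOSED additive subgroup
`𝓡𝒳 ≤ 𝒳`, with `ι (𝓡𝒴) ⊆ 𝓡𝒴′`, `H (𝓡𝒳) ⊆ 𝓡𝒴`, `C (𝓡𝒴′) ⊆ 𝓡𝒳` («the operators are real»): at a real exponent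
`Y ∈ 𝓡𝒴`, `‖Y‖ < ε`, THE correction is real. [folklore] -/
theorem corrAt_mem_addSubgroup (hC₂ : 0 ≤ C₂) (hCq : ∀ Z : 𝒴', ‖Z‖ < R → ‖C Z‖ ≤ C₂ * ‖Z‖ ^ 2)
    (hCd : DifferentiableOn ℂ C (ball 0 R)) (hι : ∀ Y, ‖ι Y‖ ≤ ‖Y‖) (hB₀ : 0 ≤ B₀)
    (hH : ∀ X, ‖H X‖ ≤ B₀ * ‖X‖) (hq : 9 * C₂ * B₀ * ε < 1) (hRC : 3 * ε ≤ R) {Y : 𝒴} (hY : ‖Y‖ < ε)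
    (𝓡𝒴 : AddSubgroup 𝒴) (𝓡𝒴' : AddSubgroup 𝒴') (𝓡𝒳 : AddSubgroup 𝒳) (h𝓡𝒳 : IsClosed (𝓡𝒳 : Set 𝒳))
    (hιr : ∀ Y ∈ 𝓡𝒴, ι Y ∈ 𝓡𝒴') (hHr : ∀ X ∈ 𝓡𝒳, H X ∈ 𝓡𝒴) (hCr : ∀ Z ∈ 𝓡𝒴', C Z ∈ 𝓡𝒳)
    (hYr : Y ∈ 𝓡𝒴) :
    corrAt C ι H (4 * C₂ * ε ^ 2) Y ∈ (𝓡𝒳 : Set 𝒳) :=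
  corrAt_mem_of_invariant hC₂ hCq hCd hι hB₀ hH hq hRC hY (𝓡𝒳 : Set 𝒳) h𝓡𝒳 𝓡𝒳.zero_mem
    fun X' hX' _ => by
      rw [← map_sub]
      exact hCr _ (hιr _ (𝓡𝒴.sub_mem hYr (hHr X' hX')))

/-- **REALITY OF THE CANONICAL LANDAU EXPONENT** `Ψ̂(Y) = Y − H D(Y)`: under the same data, `landauExp C ι H (4C₂ε²) Y ∈
𝓡𝒴` for a real exponent `Y ∈ 𝓡𝒴` with `‖Y‖ < ε`. [folklore] -/
theorem landauExp_mem_addSubgroup (hC₂ : 0 ≤ C₂) (hCq : ∀ Z : 𝒴', ‖Z‖ < R → ‖C Z‖ ≤ C₂ * ‖Z‖ ^ 2)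
    (hCd : DifferentiableOn ℂ C (ball 0 R)) (hι : ∀ Y, ‖ι Y‖ ≤ ‖Y‖) (hB₀ : 0 ≤ B₀)
    (hH : ∀ X, ‖H X‖ ≤ B₀ * ‖X‖) (hq : 9 * C₂ * B₀ * ε < 1) (hRC : 3 * ε ≤ R) {Y : 𝒴} (hY : ‖Y‖ < ε)
    (𝓡𝒴 : AddSubgroup 𝒴) (𝓡𝒴' : AddSubgroup 𝒴') (𝓡𝒳 : AddSubgroup 𝒳) (h𝓡𝒳 : IsClosed (𝓡𝒳 : Set 𝒳))
    (hιr : ∀ Y ∈ 𝓡𝒴, ι Y ∈ 𝓡𝒴') (hHr : ∀ X ∈ 𝓡𝒳, H X ∈ 𝓡𝒴) (hCr : ∀ Z ∈ 𝓡𝒴', C Z ∈ 𝓡𝒳)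
    (hYr : Y ∈ 𝓡𝒴) :
    landauExp C ι H (4 * C₂ * ε ^ 2) Y ∈ (𝓡𝒴 : Set 𝒴) := by
  rw [landauExp_apply]
  exact 𝓡𝒴.sub_mem hYr (hHr _ (corrAt_mem_addSubgroup hC₂ hCq hCd hι hB₀ hH hq hRC hY 𝓡𝒴 𝓡𝒴' 𝓡𝒳 h𝓡𝒳
    hιr hHr hCr hYr))

end Corr

/-! ## §3 The chart instance: the exponent field of file 7″ §3 is real at real chart points -/

section Chart

variable {n : ℕ} {ℬ : Type*} [NormedAddCommGroup ℬ] [NormedSpace ℂ ℬ] [CompleteSpace 𝒴] [CompleteSpace 𝒳]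
  {𝒢 : 𝒵 →L[ℂ] 𝒴} {W𝒱 : 𝒴 → 𝒵} {B₀ C₄ a₃ : ℝ}

omit [NormedSpace ℂ ℬ] in
/-- a real chart point of the closed ball lies in the polydisc of the coarse-field map: `‖cplx y‖ < r_Φ` for
`‖y‖ ≤ S < r_Φ`. [folklore] -/
theorem cplx_mem_ball {y : Fin n → ℝ} {S rΦ : ℝ} (hy : ‖y‖ ≤ S) (hSr : S < rΦ) :
    cplx y ∈ ball (0 : Fin n → ℂ) rΦ :=
  mem_ball_zero_iff.2 ((norm_cplx_le y).trans_lt (hy.trans_lt hSr))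

/-- **THE CANONICAL LANDAU EXPONENT FIELD IS REAL AT REAL CHART POINTS.**  Binders: the S22 data of file 7″ §3
(`ShellMeasureLandauHolonomyChart.hAN_landau_chartRay`) that concern the point — (P2) `h𝒢`; (P4) `hW`; (118)/(121) at
`a = B₀b`, `j = 0` (`hdom`/`hself`/`hcontr`); (103) `hH₁`; (75) `hΦ` on the polydisc `‖z‖ < r_Φ` with `S < r_Φ`;
(44)+[4] Prop. 7 `hCq`/`hCd`; scaling `hι`; (46) `hH`; (54)-smallness `hq`/`hRC` at `ε₄ + B₀b` — AND THE REAL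
STRUCTURE: additive subgroups `𝓡𝒴` (closed), `𝓡𝒵`, `𝓡𝒴′`, `𝓡𝒳` (closed), `𝓡ℬ` with `𝒢 (𝓡𝒵) ⊆ 𝓡𝒴`,
`W𝒱 (𝓡𝒴) ⊆ 𝓡𝒵`, `ι (𝓡𝒴) ⊆ 𝓡𝒴′`, `H (𝓡𝒳) ⊆ 𝓡𝒴`, `C (𝓡𝒴′) ⊆ 𝓡𝒳`, `H₁ (𝓡ℬ) ⊆ 𝓡𝒴`, and a coarse-field map REAL
AT REAL POINTS, `Φ (cplx y) ∈ 𝓡ℬ` for `‖y‖ ≤ S`.  CONCLUSION: at every real chart point `‖y‖ ≤ S` the exponent field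
of 7″ §3, `landauExp C ι H (4C₂(ε₄+B₀b)²) (solAt 𝒢 0 W𝒱 ε₄ 0 (H₁ (Φ (cplx y))) + H₁ (Φ (cplx y)))`, lies in `𝓡𝒴`.
Nothing printed asserted; the real structure is a displayed binder, not an instance. [folklore] -/
theorem landauField_mem_real (h𝒢 : ∀ f, ‖𝒢 f‖ ≤ B₀ * ‖f‖) (hW : Prop4Hyp W𝒱 C₄ a₃) (hB₀ : 0 < B₀) (hC₄ : 0 ≤ C₄)
    {b ε₄ : ℝ} (hε₄ : 0 ≤ ε₄) (hdom : 2 * (ε₄ + B₀ * b) ≤ a₃)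
    (hself : B₀ * C₄ * (ε₄ + B₀ * b) ^ 2 ≤ ε₄) (hcontr : 4 * B₀ * C₄ * (ε₄ + B₀ * b) < 1)
    (H₁ : ℬ →L[ℂ] 𝒴) (hH₁ : ∀ B, ‖H₁ B‖ ≤ B₀ * ‖B‖)
    {Φ : (Fin n → ℂ) → ℬ} {rΦ S : ℝ} (hΦ : ∀ z ∈ ball (0 : Fin n → ℂ) rΦ, ‖Φ z‖ < b) (hSr : S < rΦ)
    {C : 𝒴' → 𝒳} {C₂ R : ℝ} (hC₂ : 0 ≤ C₂) (hCq : ∀ Z : 𝒴', ‖Z‖ < R → ‖C Z‖ ≤ C₂ * ‖Z‖ ^ 2)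
    (hCd : DifferentiableOn ℂ C (ball 0 R)) (ι : 𝒴 →L[ℂ] 𝒴') (hι : ∀ Y, ‖ι Y‖ ≤ ‖Y‖) (H : 𝒳 →L[ℂ] 𝒴)
    (hH : ∀ X, ‖H X‖ ≤ B₀ * ‖X‖) (hq : 9 * C₂ * B₀ * (ε₄ + B₀ * b) < 1) (hRC : 3 * (ε₄ + B₀ * b) ≤ R)
    -- the real structure
    (𝓡𝒴 : AddSubgroup 𝒴) (h𝓡𝒴 : IsClosed (𝓡𝒴 : Set 𝒴)) (𝓡𝒵 : AddSubgroup 𝒵) (𝓡𝒴' : AddSubgroup 𝒴')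
    (𝓡𝒳 : AddSubgroup 𝒳) (h𝓡𝒳 : IsClosed (𝓡𝒳 : Set 𝒳)) (𝓡ℬ : AddSubgroup ℬ)
    (h𝒢r : ∀ f ∈ 𝓡𝒵, 𝒢 f ∈ 𝓡𝒴) (hWr : ∀ Y ∈ 𝓡𝒴, W𝒱 Y ∈ 𝓡𝒵) (hιr : ∀ Y ∈ 𝓡𝒴, ι Y ∈ 𝓡𝒴')
    (hHr : ∀ X ∈ 𝓡𝒳, H X ∈ 𝓡𝒴) (hCr : ∀ Z ∈ 𝓡𝒴', C Z ∈ 𝓡𝒳) (hH₁r : ∀ B ∈ 𝓡ℬ, H₁ B ∈ 𝓡𝒴)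
    (hΦr : ∀ y : Fin n → ℝ, ‖y‖ ≤ S → Φ (cplx y) ∈ 𝓡ℬ)
    {y : Fin n → ℝ} (hy : ‖y‖ ≤ S) :
    landauExp C ι H (4 * C₂ * (ε₄ + B₀ * b) ^ 2)
        (solAt 𝒢 0 W𝒱 ε₄ (0 : 𝒵) (H₁ (Φ (cplx y))) + H₁ (Φ (cplx y))) ∈ (𝓡𝒴 : Set 𝒴) := by
  -- the datum `𝔄 = H₁ (Φ (cplx y))` is real and small
  have h𝔄r : H₁ (Φ (cplx y)) ∈ 𝓡𝒴 := hH₁r _ (hΦr y hy)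
  have h𝔄 : ‖H₁ (Φ (cplx y))‖ < B₀ * b :=
    (hH₁ _).trans_lt (mul_lt_mul_of_pos_left (hΦ _ (cplx_mem_ball hy hSr)) hB₀)
  -- the scheme at `Λ = 0`, `J = 0`
  have hΛ : ∀ Y : 𝒴, ‖(0 : 𝒴 →L[ℂ] 𝒴) Y‖ ≤ 0 * ‖Y‖ := fun Y => by simp
  have hself' : B₀ * 0 + 0 * (ε₄ + B₀ * b) + B₀ * C₄ * (ε₄ + B₀ * b) ^ 2 ≤ ε₄ := by simpa using hself
  have hcontr' : 0 + 4 * B₀ * C₄ * (ε₄ + B₀ * b) < 1 := by simpa using hcontr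
  have hJ : ‖(0 : 𝒵)‖ ≤ 0 := norm_zero.le
  -- THE solution at the real datum is real (§1) and lies in the ball
  have hsolr : solAt 𝒢 0 W𝒱 ε₄ (0 : 𝒵) (H₁ (Φ (cplx y))) ∈ (𝓡𝒴 : Set 𝒴) :=
    solAt_mem_addSubgroup h𝒢 hΛ hW hB₀.le hC₄ le_rfl hJ h𝔄 hε₄ hdom hself' hcontr' 𝓡𝒴 h𝓡𝒴 𝓡𝒵 h𝒢r
      (fun _ _ => by simp) hWr 𝓡𝒵.zero_mem h𝔄r
  have hsol := solAt_spec_of_scheme h𝒢 hΛ hW hB₀.le hC₄ le_rfl hJ h𝔄 hε₄ hdom hself' hcontr'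
  -- the exponent `Y = X + 𝔄` is real and small; §2 makes `Ψ̂(Y)` real
  have hYr : solAt 𝒢 0 W𝒱 ε₄ (0 : 𝒵) (H₁ (Φ (cplx y))) + H₁ (Φ (cplx y)) ∈ 𝓡𝒴 := 𝓡𝒴.add_mem hsolr h𝔄r
  have hY : ‖solAt 𝒢 0 W𝒱 ε₄ (0 : 𝒵) (H₁ (Φ (cplx y))) + H₁ (Φ (cplx y))‖ < ε₄ + B₀ * b :=
    norm_arg_lt h𝔄 hsol.1
  exact landauExp_mem_addSubgroup hC₂ hCq hCd hι hB₀.le hH hq hRC hY 𝓡𝒴 𝓡𝒴' 𝓡𝒳 h𝓡𝒳 hιr hHr hCr hYr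

end Chart

end Summit.QuantumFields.BalabanUV.T4Continuum.ShellMeasureLandauHolonomyReal
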